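import Mathlib
import Literature.Analysis.Convex.AndersonAcceleration
import Literature.Analysis.Convex.RestartedPDHG
import HarnessLib

/-!
# Safeguarded Anderson acceleration in an equivalent Euclidean geometry, and for the PDHG kernel
# (Zhang–O'Donoghue–Boyd 2020, Thm 6, transported to the metric `M_{τ,σ}` of Chambolle–Pock / PDLP)

Topic `Literature/Analysis/Convex` (companion of `AndersonAcceleration.lean` — the safeguarded scheme
`IsSafeguardedAA`, the residual `resid`, the envelope bookkeeping `envelope`/`summable_envelope` — and of
`PrimalDualHybridGradient.lean` / `RestartedPDHG.lean` — the PDHG step `pdhgStep`, its metric `M_{τ,σ}`,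
the `M`-seminorm `normM` with its triangle inequality, and the Fejér property
`normM_pdhgStep_sub_le`). Namespace `Literature.Analysis.Convex.AndersonAccelerationPDHG`. Everything
PROVED; no named facts, no `sorry`.

Sources. [ZOB20] J. Zhang, B. O'Donoghue, S. Boyd, SIAM J. Optim. 30 (2020) 3170–3197 =
arXiv:1808.03971 [ZhangOdonoghueBoyd2020] (held; §3.3 Algorithm 3, §4 Steps 1–3 and **Theorem 6**:
"Suppose that `{x^k}` is generated by Algorithm 3, then `lim_k x^k = x⋆`, where `x⋆ = f(x⋆)`", for `f`
non-expansive IN THE ℓ₂-NORM; §6 Cor 8: quasi-nonexpansive suffices; §5.1.3 / §6: "the ℓ₂-norm in the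
definition of non-expansiveness is essential to our analysis"). [CP15] A. Chambolle, T. Pock, Math.
Program. 159 (2016) 253–287 [ChambollePock2015] (§3 (12)–(13): one PDHG step is a proximal-point step
in the metric `M_{τ,σ}`, "positive-definite as soon as `τσL² < 1`"). [AHLL] D. Applegate, O. Hinder,
H. Lu, M. Lubin, Math. Program. 201 (2023) 133–184 [ApplegateEtAl2022] (Prop. 1–2 (i): PDHG is
non-expansive towards saddle points in `‖z‖² = zᵀMz`).

WHAT IS TYPED. An ℓ₂-type norm on `ℝⁿ` given by a positive definite `M` — `‖d‖_M = √⟨d, Md⟩` — is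
the Euclidean norm in the coordinates `M^{1/2} d`; so [ZOB20, Thm 6] applies to any map that is
(quasi-)nonexpansive in `‖·‖_M`, the ℓ₂ safeguard of Algorithm 3 (lines 12–13) turning into an
`‖·‖_M`-safeguard with constants rescaled by the norm-equivalence constants. We type exactly this:

§1 `IsEuclideanGauge N m Mu` — a gauge `N : E → ℝ` on a real normed space with `m‖d‖ ≤ N d ≤ Mu‖d‖`
(`m > 0`, `Mu ≥ 0`), `N(a • d) = |a| N d`, `N(u + v) ≤ N u + N v`, and the parallelogram-type identity
`N((1−t)a + tb)² = (1−t)N(a)² + tN(b)² − t(1−t)N(a−b)²` (what Step 1 (12) of the printed proof uses of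
the inner product); `isEuclideanGauge_norm` (the norm of an inner product space, `m = Mu = 1`).

§2 **`exists_tendsto_of_isSafeguardedAA_gauge`** — [ZOB20, Thm 6 / Cor 8] in the geometry of `N`: on a
proper real normed space, `f` continuous and quasi-nonexpansive IN `N` towards its nonempty fixed-point
set, `0 < α < 1`, `C ≥ 0`, `b ≥ 0` summable, and the scheme `IsSafeguardedAA f α C b S x` of
`AndersonAcceleration.lean` (KM steps / accepted steps with the safeguard measured in the ambient norm)
⇒ `x^k → x⋆ = f(x⋆)`. Proof = the printed Steps 1–3 with `‖·‖₂` replaced by `N` (`gauge_norm_succ_sub_le`,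
`gauge_norm_sub_le_bound`, `gauge_norm_succ_sub_sq_le`, `gauge_summable_kmDecrease`,
`gauge_tendsto_norm_resid`), the accepted-step errors being `Mu·C·B_k` (§2 also lists `qM_le_norm_sq` /
`norm_sq_le_normM_sq`, the two norm-equivalence estimates for `‖·‖_M` against the sup-norm of `X × Y`).

§3 THE PDHG KERNEL. `isEuclideanGauge_normM` — for `τ, σ > 0`, `τσ‖K‖² < 1` the `M`-seminorm
`RestartedPDHG.normM K τ σ` is such a gauge on `X × Y` (constants
`m = √((1 − √(τσ)‖K‖)·min(τ⁻¹, σ⁻¹))`, `Mu = √(τ⁻¹ + σ⁻¹ + 2‖K‖)`); and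
**`exists_tendsto_of_isSafeguardedAA_pdhgStep`** — safeguarded Anderson acceleration run on the PDHG
map `pdhgStep K τ σ jA jB` (monotone `A`, `B` with resolvent maps, finite dimension, a saddle point
exists) converges to a saddle point: `z^k → z⋆` with `z⋆ ∈ zer F`, `F = (A + K*·) × (B − K·)`.

§4 PLAIN FALL-BACK STEPS (`α = 1`) for a FIRMLY quasi-nonexpansive map (resolvent / proximal-point
steps: `N(f z − y)² + N(z − f z)² ≤ N(z − y)²`): `IsEuclideanGauge.reflect_le_of_firm` and
`isSafeguardedAA_reflect` (the plain step of `f` is the KM step with `α = ½` of the reflection `2f − I`,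
[ZOB20, §5.1.2]: "a ½-averaged (and hence non-expansive) operator"),
**`exists_tendsto_of_isSafeguardedAA_gauge_of_firm`**; for PDHG: `normM_pdhgStep_firm` (the tree's
`fejer_step` in `‖·‖_M`), **`exists_tendsto_of_isSafeguardedAA_pdhgStep_plain`** (accepted Anderson steps
under the safeguard, otherwise the plain update `z^{k+1} = pdhgStep z^k` — the form in which an AA-PDHG
kernel is actually run) and its conic / projection form `exists_tendsto_of_isSafeguardedAA_pdhgStep_conic`
(resolvents `P_C(· − τc)`, `P_D(· − σb)` as in `PrimalDualHybridGradient.tendsto_pdhgIter_conic`).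

§5 the same for Douglas–Rachford splitting with PLAIN DR fall-back steps (the SCS form):
`norm_drStep_firm`, **`exists_tendsto_of_isSafeguardedAA_drStep_plain`**.

Deviations: [ZOB20] state Theorem 6 for the ℓ₂-norm only and list non-Euclidean norms as open (§6);
the `M`-geometry is Euclidean (an inner product), and the transport is the standard change of variables —
recorded here, not printed there in this form. The PDHG corollary is for FIXED `(τ, σ)` (the map must
not change along the iteration; adaptive steps / primal-weight updates are outside, cf. [ZOB20, Cor 9]).
No rate is claimed (none is printed). Floating point is not modelled.
-/

namespace Literature.Analysis.Convex.AndersonAccelerationPDHG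

open _root_.Filter _root_.Topology Finset
open scoped RealInnerProductSpace
open Literature.Analysis.Convex.AndersonAcceleration
open Literature.Analysis.Convex.KrasnoselskijIteration (norm_sq_convex_combination)
open Literature.Analysis.Convex.ProximalPointAlgorithm (le_add_tsum_of_le_add
  tendsto_zero_of_le_add_of_summable)

/-! ## §1 Equivalent Euclidean gauges -/

section Gauge

variable {E : Type*} [NormedAddCommGroup E] [NormedSpace ℝ E]

/-- **An equivalent Euclidean gauge** on a real normed space: `N` is absolutely homogeneous,
subadditive, equivalent to the norm (`m‖d‖ ≤ N d ≤ Mu‖d‖`, `m > 0`) and satisfies the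
parallelogram-type identity of an inner-product norm,
`N((1−t)a + tb)² = (1−t)N(a)² + tN(b)² − t(1−t)N(a − b)²` — e.g. `‖d‖_M = √⟨d, Md⟩` for a positive
definite `M` ([CP15]: "`M_{τ,σ}` … positive-definite as soon as `τσL² < 1`"). This is the structure the
printed Step 1 uses of the ℓ₂-norm. [cite: ZhangOdonoghueBoyd2020, §4 Step 1 ((10)–(13))]
[cite: ChambollePock2015, §3 (12)–(13)] -/
structure IsEuclideanGauge (N : E → ℝ) (m Mu : ℝ) : Prop where
  /-- `m > 0` -/
  m_pos : 0 < m
  /-- `Mu ≥ 0` -/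
  Mu_nonneg : 0 ≤ Mu
  /-- `m‖d‖ ≤ N d` -/
  lower : ∀ d, m * ‖d‖ ≤ N d
  /-- `N d ≤ Mu‖d‖` -/
  upper : ∀ d, N d ≤ Mu * ‖d‖
  /-- absolute homogeneity -/
  smul : ∀ (a : ℝ) (d : E), N (a • d) = |a| * N d
  /-- subadditivity -/
  add_le : ∀ u v, N (u + v) ≤ N u + N v
  /-- the parallelogram-type identity of an inner-product norm -/
  sq_convex : ∀ (a b : E) (t : ℝ),
    N ((1 - t) • a + t • b) ^ 2 = (1 - t) * N a ^ 2 + t * N b ^ 2 - t * (1 - t) * N (a - b) ^ 2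

namespace IsEuclideanGauge

variable {N : E → ℝ} {m Mu : ℝ}

/-- `N ≥ 0`. [cite: ZhangOdonoghueBoyd2020, §4 Step 1] -/
theorem nonneg (hN : IsEuclideanGauge N m Mu) (d : E) : 0 ≤ N d :=
  (mul_nonneg hN.m_pos.le (norm_nonneg d)).trans (hN.lower d)

/-- `N 0 = 0`. [cite: ApplegateEtAl2022, §1 (4) (semi-norm)] -/
theorem map_zero (hN : IsEuclideanGauge N m Mu) : N 0 = 0 := by
  have := hN.smul 0 0
  rw [zero_smul, abs_zero, zero_mul] at this
  exact this

/-- `N(−d) = N d`. [cite: ApplegateEtAl2022, §1 (4) (semi-norm)] -/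
theorem map_neg (hN : IsEuclideanGauge N m Mu) (d : E) : N (-d) = N d := by
  rw [← neg_one_smul ℝ d, hN.smul]; simp

/-- `N(u − w) ≤ N(u − v) + N(v − w)`. [cite: ApplegateEtAl2022, §1 (4) (semi-norm)] -/
theorem sub_le (hN : IsEuclideanGauge N m Mu) (u v w : E) : N (u - w) ≤ N (u - v) + N (v - w) := by
  have h := hN.add_le (u - v) (v - w)
  rwa [sub_add_sub_cancel] at h

/-- `N` is `Mu`-Lipschitz, hence continuous. [cite: ChambollePock2015, §3 (12)] -/
theorem abs_sub_le (hN : IsEuclideanGauge N m Mu) (u v : E) : |N u - N v| ≤ Mu * ‖u - v‖ := by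
  rw [abs_sub_le_iff]
  constructor
  · have h := hN.add_le v (u - v)
    rw [add_sub_cancel] at h
    linarith [hN.upper (u - v)]
  · have h := hN.add_le u (v - u)
    rw [add_sub_cancel] at h
    have h2 : N (v - u) ≤ Mu * ‖u - v‖ := by rw [← norm_neg, neg_sub]; exact hN.upper _
    linarith

/-- `N` is `Mu`-Lipschitz, hence continuous. [cite: ChambollePock2015, §3 (12)] -/
theorem continuous (hN : IsEuclideanGauge N m Mu) : Continuous N :=
  (LipschitzWith.of_dist_le_mul (K := ⟨Mu, hN.Mu_nonneg⟩) fun u v => by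
    rw [Real.dist_eq, dist_eq_norm]
    exact hN.abs_sub_le u v).continuous

/-- `‖d‖ ≤ N d / m`. [cite: ChambollePock2015, §3 (after (12))] -/
theorem norm_le (hN : IsEuclideanGauge N m Mu) (d : E) : ‖d‖ ≤ N d / m := by
  rw [le_div_iff₀ hN.m_pos, mul_comm]; exact hN.lower d

/-- **The KM inequality in the gauge** ((12) of the printed proof): for `f` quasi-nonexpansive in `N`
towards the fixed point `y` and `0 ≤ α`,
`N(f_α(z) − y)² ≤ N(z − y)² − α(1−α) N(g(z))²`. [cite: ZhangOdonoghueBoyd2020, §4 Step 1 (12)] -/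
theorem kmStep_sq_le (hN : IsEuclideanGauge N m Mu) {f : E → E} {α : ℝ} (hα0 : 0 ≤ α) {y z : E}
    (hfy : N (f z - y) ≤ N (z - y)) :
    N (((1 - α) • z + α • f z) - y) ^ 2 ≤ N (z - y) ^ 2 - α * (1 - α) * N (resid f z) ^ 2 := by
  have h1 : ((1 - α) • z + α • f z) - y = (1 - α) • (z - y) + α • (f z - y) := by module
  have h2 : (z - y) - (f z - y) = resid f z := by simp only [resid]; abel
  rw [h1, hN.sq_convex, h2]
  have h3 : N (f z - y) ^ 2 ≤ N (z - y) ^ 2 := pow_le_pow_left₀ (hN.nonneg _) hfy 2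
  nlinarith

/-- The KM step is quasi-nonexpansive in the gauge: `N(f_α(z) − y) ≤ N(z − y)` for `0 ≤ α ≤ 1`.
[cite: ZhangOdonoghueBoyd2020, §4 Step 1 (12)] -/
theorem kmStep_le (hN : IsEuclideanGauge N m Mu) {f : E → E} {α : ℝ} (hα0 : 0 ≤ α) (hα1 : α ≤ 1)
    {y z : E} (hfy : N (f z - y) ≤ N (z - y)) :
    N (((1 - α) • z + α • f z) - y) ≤ N (z - y) := by
  have h1 : ((1 - α) • z + α • f z) - y = (1 - α) • (z - y) + α • (f z - y) := by module
  rw [h1]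
  calc N ((1 - α) • (z - y) + α • (f z - y)) ≤ N ((1 - α) • (z - y)) + N (α • (f z - y)) :=
        hN.add_le _ _
    _ = (1 - α) * N (z - y) + α * N (f z - y) := by
        rw [hN.smul, hN.smul, abs_of_nonneg (by linarith), abs_of_nonneg hα0]
    _ ≤ (1 - α) * N (z - y) + α * N (z - y) :=
        add_le_add le_rfl (mul_le_mul_of_nonneg_left hfy hα0)
    _ = N (z - y) := by ring

end IsEuclideanGauge

/-- The norm of a real inner product space is an equivalent Euclidean gauge with `m = Mu = 1`
(so §2 below contains [ZOB20, Thm 6] verbatim). [cite: ZhangOdonoghueBoyd2020, §4 Thm 6 (ℓ₂-norm)] -/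
theorem isEuclideanGauge_norm {F : Type*} [NormedAddCommGroup F] [InnerProductSpace ℝ F] :
    IsEuclideanGauge (fun d : F => ‖d‖) 1 1 where
  m_pos := one_pos
  Mu_nonneg := zero_le_one
  lower d := by rw [one_mul]
  upper d := by rw [one_mul]
  smul a d := by rw [norm_smul, Real.norm_eq_abs]
  add_le u v := norm_add_le u v
  sq_convex a b t := norm_sq_convex_combination a b t

end Gauge

/-! ## §2 [ZOB20, Thm 6] in the geometry of an equivalent Euclidean gauge -/

section Transport

variable {E : Type*} [NormedAddCommGroup E] [NormedSpace ℝ E]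
variable {N : E → ℝ} {m Mu : ℝ} {f : E → E} {α C : ℝ} {b : ℕ → ℝ} {S : ℕ → Prop} {x : ℕ → E}

/-- At an accepted step, the gauge of the step is under the rescaled envelope:
`N(x^{k+1} − x^k) ≤ Mu·C·B_k`. [cite: ZhangOdonoghueBoyd2020, §4 Step 1 (10)] -/
theorem gauge_step_le (hN : IsEuclideanGauge N m Mu) (hx : IsSafeguardedAA f α C b S x)
    (hC : 0 ≤ C) (hMu : 0 ≤ Mu) {k : ℕ} (hk : S k) :
    N (x (k + 1) - x k) ≤ Mu * C * envelope b S k :=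
  (hN.upper _).trans (by
    have := norm_step_le hx hC hk
    calc Mu * ‖x (k + 1) - x k‖ ≤ Mu * (C * envelope b S k) := mul_le_mul_of_nonneg_left this hMu
      _ = Mu * C * envelope b S k := by ring)

/-- At an accepted step, the gauge of the residual is under the rescaled envelope: `N(g_k) ≤ Mu·B_k`.
[cite: ZhangOdonoghueBoyd2020, §3.3 Algorithm 3 (line 12)] -/
theorem gauge_resid_le (hN : IsEuclideanGauge N m Mu) (hx : IsSafeguardedAA f α C b S x)
    (hMu : 0 ≤ Mu) {k : ℕ} (hk : S k) : N (resid f (x k)) ≤ Mu * envelope b S k :=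
  (hN.upper _).trans (mul_le_mul_of_nonneg_left (norm_resid_le_envelope hx hk) hMu)

/-- **Step 1, (10)–(11) in the gauge**: `N(x^{k+1} − y) ≤ N(x^k − y) + Mu·C·B_k` for `f`
quasi-nonexpansive in `N` towards `y`, `0 ≤ α ≤ 1`. [cite: ZhangOdonoghueBoyd2020, §4 Step 1 ((10), (11), (16))] -/
theorem gauge_norm_succ_sub_le (hN : IsEuclideanGauge N m Mu) (hx : IsSafeguardedAA f α C b S x)
    (hC : 0 ≤ C) (hMu : 0 ≤ Mu) (hα0 : 0 ≤ α) (hα1 : α ≤ 1) {y : E}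
    (hfy : ∀ z, N (f z - y) ≤ N (z - y)) (k : ℕ) :
    N (x (k + 1) - y) ≤ N (x k - y) + Mu * C * envelope b S k := by
  by_cases hk : S k
  · calc N (x (k + 1) - y) ≤ N (x (k + 1) - x k) + N (x k - y) := hN.sub_le _ _ _
      _ ≤ Mu * C * envelope b S k + N (x k - y) := add_le_add (gauge_step_le hN hx hC hMu hk) le_rfl
      _ = N (x k - y) + Mu * C * envelope b S k := add_comm _ _
  · rw [hx.km_step k hk, envelope_of_not_mem hk, mul_zero, add_zero]
    exact hN.kmStep_le hα0 hα1 (hfy (x k))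

/-- **Step 1, (11) in the gauge**: `N(x^k − y) ≤ N(x^0 − y) + Mu·C·Σ_k B_k`.
[cite: ZhangOdonoghueBoyd2020, §4 Step 1 (11)] -/
theorem gauge_norm_sub_le_bound (hN : IsEuclideanGauge N m Mu) (hx : IsSafeguardedAA f α C b S x)
    (hC : 0 ≤ C) (hMu : 0 ≤ Mu) (hα0 : 0 ≤ α) (hα1 : α ≤ 1) (hb : ∀ i, 0 ≤ b i) (hbs : Summable b)
    {y : E} (hfy : ∀ z, N (f z - y) ≤ N (z - y)) (k : ℕ) :
    N (x k - y) ≤ N (x 0 - y) + ∑' j, Mu * C * envelope b S j :=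
  le_add_tsum_of_le_add (a := fun k => N (x k - y))
    (fun j => mul_nonneg (mul_nonneg hMu hC) (envelope_nonneg hb j))
    (gauge_norm_succ_sub_le hN hx hC hMu hα0 hα1 hfy) (((summable_envelope hb hbs).mul_left (Mu * C))) k

open Classical in
/-- The KM decrease term in the gauge, `G_k = α(1−α)N(g_k)²` at KM steps, `0` at accepted steps.
[cite: ZhangOdonoghueBoyd2020, §4 Step 1 (12)] -/
noncomputable def gaugeKmDecrease (N : E → ℝ) (f : E → E) (α : ℝ) (S : ℕ → Prop) (x : ℕ → E)
    (k : ℕ) : ℝ :=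
  if S k then 0 else α * (1 - α) * N (resid f (x k)) ^ 2

omit [NormedSpace ℝ E] in
/-- `G_k ≥ 0`. [cite: ZhangOdonoghueBoyd2020, §4 Step 1 (12)] -/
theorem gaugeKmDecrease_nonneg (hα0 : 0 ≤ α) (hα1 : α ≤ 1) (k : ℕ) :
    0 ≤ gaugeKmDecrease N f α S x k := by
  unfold gaugeKmDecrease
  split_ifs
  · exact le_rfl
  · exact mul_nonneg (mul_nonneg hα0 (by linarith)) (sq_nonneg _)

/-- **Step 1, (12)–(13) in the gauge**: `N(x^{k+1} − y)² + G_k ≤ N(x^k − y)² + (2R + T)·(Mu C B_k)`.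
[cite: ZhangOdonoghueBoyd2020, §4 Step 1 ((12), (13))] -/
theorem gauge_norm_succ_sub_sq_le (hN : IsEuclideanGauge N m Mu) (hx : IsSafeguardedAA f α C b S x)
    (hC : 0 ≤ C) (hMu : 0 ≤ Mu) (hα0 : 0 ≤ α) (hα1 : α ≤ 1) (hb : ∀ i, 0 ≤ b i) (hbs : Summable b)
    {y : E} (hfy : ∀ z, N (f z - y) ≤ N (z - y)) (k : ℕ) :
    N (x (k + 1) - y) ^ 2 + gaugeKmDecrease N f α S x k ≤
      N (x k - y) ^ 2 +
        (2 * (N (x 0 - y) + ∑' j, Mu * C * envelope b S j) + ∑' j, Mu * C * envelope b S j) *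
          (Mu * C * envelope b S k) := by
  set R : ℝ := N (x 0 - y) + ∑' j, Mu * C * envelope b S j with hR
  set T : ℝ := ∑' j, Mu * C * envelope b S j with hT
  have he0 : 0 ≤ Mu * C * envelope b S k := mul_nonneg (mul_nonneg hMu hC) (envelope_nonneg hb k)
  have hsum : Summable fun j => Mu * C * envelope b S j :=
    (summable_envelope hb hbs).mul_left (Mu * C)
  have heT : Mu * C * envelope b S k ≤ T :=
    hsum.le_tsum k fun j _ => mul_nonneg (mul_nonneg hMu hC) (envelope_nonneg hb j)
  have hRk : N (x k - y) ≤ R := gauge_norm_sub_le_bound hN hx hC hMu hα0 hα1 hb hbs hfy k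
  have hN0 : 0 ≤ N (x 0 - y) := hN.nonneg _
  have hNk : 0 ≤ N (x k - y) := hN.nonneg _
  by_cases hk : S k
  · have hkm : gaugeKmDecrease N f α S x k = 0 := if_pos hk
    rw [hkm, add_zero]
    have h1 : N (x (k + 1) - y) ≤ N (x k - y) + Mu * C * envelope b S k :=
      gauge_norm_succ_sub_le hN hx hC hMu hα0 hα1 hfy k
    have h2 : N (x (k + 1) - y) ^ 2 ≤ (N (x k - y) + Mu * C * envelope b S k) ^ 2 :=
      pow_le_pow_left₀ (hN.nonneg _) h1 2
    nlinarith
  · have hkm : gaugeKmDecrease N f α S x k = α * (1 - α) * N (resid f (x k)) ^ 2 := if_neg hk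
    rw [hkm, hx.km_step k hk, envelope_of_not_mem hk, mul_zero, mul_zero, add_zero]
    have := hN.kmStep_sq_le (f := f) hα0 (hfy (x k))
    linarith

/-- **Step 1, (14) in the gauge**: the KM decrease terms are summable.
[cite: ZhangOdonoghueBoyd2020, §4 Step 1 (14)] -/
theorem gauge_summable_kmDecrease (hN : IsEuclideanGauge N m Mu)
    (hx : IsSafeguardedAA f α C b S x) (hC : 0 ≤ C) (hMu : 0 ≤ Mu) (hα0 : 0 ≤ α) (hα1 : α ≤ 1)
    (hb : ∀ i, 0 ≤ b i) (hbs : Summable b) {y : E} (hfy : ∀ z, N (f z - y) ≤ N (z - y)) :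
    Summable (gaugeKmDecrease N f α S x) := by
  set L : ℝ := 2 * (N (x 0 - y) + ∑' j, Mu * C * envelope b S j) + ∑' j, Mu * C * envelope b S j
  have hsum : Summable fun j => L * (Mu * C * envelope b S j) :=
    ((summable_envelope hb hbs).mul_left (Mu * C)).mul_left L
  have hT0 : 0 ≤ ∑' j, Mu * C * envelope b S j :=
    tsum_nonneg fun j => mul_nonneg (mul_nonneg hMu hC) (envelope_nonneg hb j)
  have hL : 0 ≤ L := by
    have := hN.nonneg (x 0 - y)
    positivity
  have htel : ∀ K, ∑ k ∈ Finset.range K, gaugeKmDecrease N f α S x k ≤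
      N (x 0 - y) ^ 2 - N (x K - y) ^ 2 + ∑ k ∈ Finset.range K, L * (Mu * C * envelope b S k) := by
    intro K
    induction K with
    | zero => simp
    | succ K ih =>
      rw [Finset.sum_range_succ, Finset.sum_range_succ]
      have := gauge_norm_succ_sub_sq_le hN hx hC hMu hα0 hα1 hb hbs hfy K
      linarith
  refine summable_of_sum_range_le (c := N (x 0 - y) ^ 2 + ∑' k, L * (Mu * C * envelope b S k))
    (gaugeKmDecrease_nonneg hα0 hα1) fun K => (htel K).trans ?_
  have h1 : ∑ k ∈ Finset.range K, L * (Mu * C * envelope b S k) ≤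
      ∑' k, L * (Mu * C * envelope b S k) :=
    hsum.sum_le_tsum _ fun k _ =>
      mul_nonneg hL (mul_nonneg (mul_nonneg hMu hC) (envelope_nonneg hb k))
  nlinarith [sq_nonneg (N (x K - y))]

/-- **Step 1, (15) in the gauge**: `N(g_k) → 0`, hence `‖g_k‖ → 0`.
[cite: ZhangOdonoghueBoyd2020, §4 Step 1 (15)] -/
theorem gauge_tendsto_norm_resid (hN : IsEuclideanGauge N m Mu)
    (hx : IsSafeguardedAA f α C b S x) (hC : 0 ≤ C) (hMu : 0 ≤ Mu) (hα0 : 0 < α) (hα1 : α < 1)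
    (hb : ∀ i, 0 ≤ b i) (hbs : Summable b) {y : E} (hfy : ∀ z, N (f z - y) ≤ N (z - y)) :
    Tendsto (fun k => ‖resid f (x k)‖) atTop (𝓝 0) := by
  -- first `N(g_k) → 0`
  have hB := tendsto_envelope (S := S) hb hbs
  have hG := (gauge_summable_kmDecrease hN hx hC hMu hα0.le hα1.le hb hbs hfy).tendsto_atTop_zero
  have hαα : 0 < α * (1 - α) := mul_pos hα0 (by linarith)
  have hNres : Tendsto (fun k => N (resid f (x k))) atTop (𝓝 0) := by
    refine Metric.tendsto_atTop.2 fun η hη => ?_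
    have h1 : ∀ᶠ k in atTop, (Mu + 1) * envelope b S k < η := by
      have := hB.const_mul (Mu + 1)
      rw [mul_zero] at this
      exact this.eventually (gt_mem_nhds hη)
    have h2 : ∀ᶠ k in atTop, gaugeKmDecrease N f α S x k < α * (1 - α) * η ^ 2 :=
      hG.eventually (gt_mem_nhds (by positivity))
    obtain ⟨K₀, hK₀⟩ := eventually_atTop.1 (h1.and h2)
    refine ⟨K₀, fun k hk => ?_⟩
    obtain ⟨hk1, hk2⟩ := hK₀ k hk
    rw [Real.dist_eq, sub_zero, abs_of_nonneg (hN.nonneg _)]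
    by_cases hS : S k
    · have h3 : N (resid f (x k)) ≤ Mu * envelope b S k := gauge_resid_le hN hx hMu hS
      have h4 : Mu * envelope b S k ≤ (Mu + 1) * envelope b S k :=
        mul_le_mul_of_nonneg_right (by linarith) (envelope_nonneg hb k)
      linarith
    · have hkm : gaugeKmDecrease N f α S x k = α * (1 - α) * N (resid f (x k)) ^ 2 := if_neg hS
      rw [hkm] at hk2
      have h3 : N (resid f (x k)) ^ 2 < η ^ 2 := lt_of_mul_lt_mul_left hk2 hαα.le
      exact (pow_lt_pow_iff_left₀ (hN.nonneg _) hη.le two_ne_zero).1 h3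
  -- then `‖g_k‖ ≤ N(g_k)/m → 0`
  refine squeeze_zero (fun k => norm_nonneg _) (fun k => hN.norm_le _) ?_
  have := hNres.div_const m
  rwa [zero_div] at this

/-- **[ZOB20, THEOREM 6 / COROLLARY 8] in the geometry of an equivalent Euclidean gauge.** On a
proper real normed space `E` with an equivalent Euclidean gauge `N` (e.g. `‖·‖_M`, `M ≻ 0`), let `f`
be continuous and quasi-nonexpansive IN `N` towards its nonempty fixed-point set
(`N(f z − y) ≤ N(z − y)` for all `z`, all fixed `y`), `0 < α < 1`, `C ≥ 0`, `(b_i)` nonnegative and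
summable, and let `x` follow the safeguarded scheme `IsSafeguardedAA f α C b S x` (safeguard measured in
the norm of `E`). Then `x^k → x⋆` for some fixed point `x⋆ = f(x⋆)` — the printed Steps 1–3 run with
`‖·‖₂` replaced by `N`, the ℓ₂-safeguard becoming an `N`-safeguard with constants `Mu·C`, `Mu·b`.
[cite: ZhangOdonoghueBoyd2020, §4 Thm 6; §6 Cor 8] [cite: ChambollePock2015, §3 (12)–(13)] -/
theorem exists_tendsto_of_isSafeguardedAA_gauge [ProperSpace E] (hN : IsEuclideanGauge N m Mu)
    (hf : Continuous f) (hq : ∀ y ∈ Function.fixedPoints f, ∀ z, N (f z - y) ≤ N (z - y))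
    (hne : (Function.fixedPoints f).Nonempty) (hα0 : 0 < α) (hα1 : α < 1) (hC : 0 ≤ C)
    (hb : ∀ i, 0 ≤ b i) (hbs : Summable b) (hx : IsSafeguardedAA f α C b S x) :
    ∃ xs ∈ Function.fixedPoints f, Tendsto x atTop (𝓝 xs) := by
  have hMu := hN.Mu_nonneg
  obtain ⟨y, hy⟩ := hne
  have hres := gauge_tendsto_norm_resid hN hx hC hMu hα0 hα1 hb hbs (hq y hy)
  have hsumE : Summable fun j => Mu * C * envelope b S j :=
    (summable_envelope hb hbs).mul_left (Mu * C)
  -- Step 2 (boundedness in the norm of `E`) and a cluster point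
  have hbd : ∀ k, x k ∈ Metric.closedBall y ((N (x 0 - y) + ∑' j, Mu * C * envelope b S j) / m) :=
    fun k => by
    rw [Metric.mem_closedBall, dist_eq_norm]
    exact (hN.norm_le _).trans (div_le_div_of_nonneg_right
      (gauge_norm_sub_le_bound hN hx hC hMu hα0.le hα1.le hb hbs (hq y hy) k) hN.m_pos.le)
  obtain ⟨q, -, φ, hφ, hlim⟩ := tendsto_subseq_of_bounded Metric.isBounded_closedBall hbd
  -- Step 3: the cluster point is a fixed point (`g(x^{φ k}) → g(q)` and `→ 0`)
  have hq_fix : q ∈ Function.fixedPoints f := by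
    rw [mem_fixedPoints_iff_resid, ← norm_eq_zero]
    have h1 : Tendsto (fun k => ‖resid f (x (φ k))‖) atTop (𝓝 ‖resid f q‖) :=
      ((continuous_resid hf).norm.tendsto q).comp hlim
    exact tendsto_nhds_unique h1 (hres.comp hφ.tendsto_atTop)
  -- quasi-Fejér towards `q` in the gauge, with a subsequence along which `N(x^k − q) → 0`
  have hsub : Tendsto ((fun k => N (x k - q)) ∘ φ) atTop (𝓝 0) := by
    have h1 : Tendsto (fun k => x (φ k) - q) atTop (𝓝 (q - q)) :=
      (hlim.sub_const q)
    rw [sub_self] at h1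
    have h2 := (hN.continuous.tendsto 0).comp h1
    rw [hN.map_zero] at h2
    exact h2
  have hNq : Tendsto (fun k => N (x k - q)) atTop (𝓝 0) :=
    tendsto_zero_of_le_add_of_summable (a := fun k => N (x k - q)) (fun k => hN.nonneg _)
      (fun j => mul_nonneg (mul_nonneg hMu hC) (envelope_nonneg hb j))
      (gauge_norm_succ_sub_le hN hx hC hMu hα0.le hα1.le (hq q hq_fix)) hsumE hφ hsub
  refine ⟨q, hq_fix, ?_⟩
  rw [tendsto_iff_norm_sub_tendsto_zero]
  refine squeeze_zero (fun k => norm_nonneg _) (fun k => hN.norm_le _) ?_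
  have := hNq.div_const m
  rwa [zero_div] at this

end Transport

/-! ## §3 The PDHG kernel: `‖·‖_M` is an equivalent Euclidean gauge, and safeguarded AA on `pdhgStep`
converges to a saddle point -/

section PDHG

open Literature.Analysis.Convex.MonotoneOperator (IsMonotone IsResolventMap zer)
open Literature.Analysis.Convex.PrimalDualHybridGradient
open Literature.Analysis.Convex.RestartedPDHG

variable {X Y : Type*} [NormedAddCommGroup X] [InnerProductSpace ℝ X] [CompleteSpace X]
  [NormedAddCommGroup Y] [InnerProductSpace ℝ Y] [CompleteSpace Y]

/-- `⟨s • u, v⟩_M = s ⟨u, v⟩_M`. [cite: ChambollePock2015, §3 (12)] -/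
theorem bM_smul_left (K : X →L[ℝ] Y) (τ σ s : ℝ) (u v : X × Y) :
    bM K τ σ (s • u) v = s * bM K τ σ u v := by
  rw [bM_comm, bM_smul_right, bM_comm]

/-- The parallelogram-type identity of the `M`-quadratic form:
`‖(1−t)a + tb‖²_M = (1−t)‖a‖²_M + t‖b‖²_M − t(1−t)‖a − b‖²_M`. [cite: ChambollePock2015, §3 (12)]
[cite: ZhangOdonoghueBoyd2020, §4 Step 1 (12)] -/
theorem qM_convex_combination (K : X →L[ℝ] Y) (τ σ : ℝ) (a b : X × Y) (t : ℝ) :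
    qM K τ σ ((1 - t) • a + t • b) =
      (1 - t) * qM K τ σ a + t * qM K τ σ b - t * (1 - t) * qM K τ σ (a - b) := by
  have h1 := qM_add_smul K τ σ ((1 - t) • a) b t
  have h2 : a - b = a + (-1 : ℝ) • b := by module
  have h3 := qM_add_smul K τ σ a b (-1)
  rw [h1, qM_smul, bM_smul_left, h2, h3]
  ring

/-- The `M`-quadratic form is dominated by the (sup-)norm of `X × Y`:
`‖d‖²_M ≤ (τ⁻¹ + σ⁻¹ + 2‖K‖) ‖d‖²`. [cite: ChambollePock2015, §3 (12)] -/
theorem qM_le_norm_sq (K : X →L[ℝ] Y) {τ σ : ℝ} (hτ : 0 < τ) (hσ : 0 < σ) (d : X × Y) :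
    qM K τ σ d ≤ (τ⁻¹ + σ⁻¹ + 2 * ‖K‖) * ‖d‖ ^ 2 := by
  rw [qM_eq, inner_metricM_self]
  simp only [WithLp.toLp_fst, WithLp.toLp_snd]
  have h1 : ‖d.1‖ ≤ ‖d‖ := norm_fst_le d
  have h2 : ‖d.2‖ ≤ ‖d‖ := norm_snd_le d
  have hK : |⟪K d.1, d.2⟫| ≤ ‖K‖ * ‖d‖ * ‖d‖ := by
    calc |⟪K d.1, d.2⟫| ≤ ‖K d.1‖ * ‖d.2‖ := abs_real_inner_le_norm _ _
      _ ≤ (‖K‖ * ‖d.1‖) * ‖d.2‖ := mul_le_mul_of_nonneg_right (K.le_opNorm _) (norm_nonneg _)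
      _ ≤ (‖K‖ * ‖d‖) * ‖d‖ := mul_le_mul (mul_le_mul_of_nonneg_left h1 (norm_nonneg _)) h2
          (norm_nonneg _) (by positivity)
  have h3 : -(‖K‖ * ‖d‖ * ‖d‖) ≤ ⟪K d.1, d.2⟫ := (abs_le.1 hK).1
  have h4 : ‖d.1‖ ^ 2 ≤ ‖d‖ ^ 2 := pow_le_pow_left₀ (norm_nonneg _) h1 2
  have h5 : ‖d.2‖ ^ 2 ≤ ‖d‖ ^ 2 := pow_le_pow_left₀ (norm_nonneg _) h2 2
  have hτ' : 0 < τ⁻¹ := inv_pos.2 hτ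
  have hσ' : 0 < σ⁻¹ := inv_pos.2 hσ
  nlinarith [mul_le_mul_of_nonneg_left h4 hτ'.le, mul_le_mul_of_nonneg_left h5 hσ'.le]

/-- Conversely `(1 − √(τσ)‖K‖)·min(τ⁻¹, σ⁻¹)·‖d‖² ≤ ‖d‖²_M` (from the tree's coercivity estimate
`euclidean_le_normM_sq`). [cite: ChambollePock2015, §3 (after (12))] -/
theorem norm_sq_le_normM_sq (K : X →L[ℝ] Y) {τ σ : ℝ} (hτ : 0 < τ) (hσ : 0 < σ)
    (hK : τ * σ * ‖K‖ ^ 2 ≤ 1) (d : X × Y) :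
    (1 - Real.sqrt (τ * σ) * ‖K‖) * min τ⁻¹ σ⁻¹ * ‖d‖ ^ 2 ≤ normM K τ σ d ^ 2 := by
  have h := euclidean_le_normM_sq K hτ hσ hK d
  have hc : 0 ≤ 1 - Real.sqrt (τ * σ) * ‖K‖ := by
    have h0 : 0 ≤ Real.sqrt (τ * σ) * ‖K‖ := by positivity
    have h1 : (Real.sqrt (τ * σ) * ‖K‖) ^ 2 ≤ 1 := by
      rw [mul_pow, Real.sq_sqrt (by positivity)]; exact hK
    nlinarith
  have hmin : min τ⁻¹ σ⁻¹ * ‖d‖ ^ 2 ≤ τ⁻¹ * ‖d.1‖ ^ 2 + σ⁻¹ * ‖d.2‖ ^ 2 := by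
    have hτ' : 0 < τ⁻¹ := inv_pos.2 hτ
    have hσ' : 0 < σ⁻¹ := inv_pos.2 hσ
    rw [Prod.norm_def]
    rcases le_total ‖d.1‖ ‖d.2‖ with h12 | h12
    · rw [max_eq_right h12]
      nlinarith [min_le_right τ⁻¹ σ⁻¹, sq_nonneg ‖d.1‖, sq_nonneg ‖d.2‖,
        mul_nonneg hτ'.le (sq_nonneg ‖d.1‖)]
    · rw [max_eq_left h12]
      nlinarith [min_le_left τ⁻¹ σ⁻¹, sq_nonneg ‖d.1‖, sq_nonneg ‖d.2‖,
        mul_nonneg hσ'.le (sq_nonneg ‖d.2‖)]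
  calc (1 - Real.sqrt (τ * σ) * ‖K‖) * min τ⁻¹ σ⁻¹ * ‖d‖ ^ 2
        = (1 - Real.sqrt (τ * σ) * ‖K‖) * (min τ⁻¹ σ⁻¹ * ‖d‖ ^ 2) := by ring
    _ ≤ (1 - Real.sqrt (τ * σ) * ‖K‖) * (τ⁻¹ * ‖d.1‖ ^ 2 + σ⁻¹ * ‖d.2‖ ^ 2) :=
        mul_le_mul_of_nonneg_left hmin hc
    _ ≤ normM K τ σ d ^ 2 := h

/-- **`‖·‖_M` is an equivalent Euclidean gauge on `X × Y`** for `τ, σ > 0`, `τσ‖K‖² < 1`, with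
`m = √((1 − √(τσ)‖K‖)·min(τ⁻¹, σ⁻¹))` and `Mu = √(τ⁻¹ + σ⁻¹ + 2‖K‖)` ("`M_{τ,σ}` … positive-definite as
soon as `τσL² < 1`"; `‖·‖_M` a semi-norm [AHLL]). [cite: ChambollePock2015, §3 (12)–(13)]
[cite: ApplegateEtAl2022, Proposition 1 (PDHG, ‖z‖² = zᵀMz)] -/
theorem isEuclideanGauge_normM (K : X →L[ℝ] Y) {τ σ : ℝ} (hτ : 0 < τ) (hσ : 0 < σ)
    (hK : τ * σ * ‖K‖ ^ 2 < 1) :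
    IsEuclideanGauge (E := X × Y) (normM K τ σ)
      (Real.sqrt ((1 - Real.sqrt (τ * σ) * ‖K‖) * min τ⁻¹ σ⁻¹))
      (Real.sqrt (τ⁻¹ + σ⁻¹ + 2 * ‖K‖)) := by
  have hc : 0 < 1 - Real.sqrt (τ * σ) * ‖K‖ := by
    have h0 : 0 ≤ Real.sqrt (τ * σ) * ‖K‖ := by positivity
    have h1 : (Real.sqrt (τ * σ) * ‖K‖) ^ 2 < 1 := by
      rw [mul_pow, Real.sq_sqrt (by positivity)]; exact hK
    nlinarith
  have hmin : 0 < min τ⁻¹ σ⁻¹ := lt_min (inv_pos.2 hτ) (inv_pos.2 hσ)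
  refine
    { m_pos := Real.sqrt_pos.2 (mul_pos hc hmin)
      Mu_nonneg := Real.sqrt_nonneg _
      lower := fun d => ?_
      upper := fun d => ?_
      smul := fun a d => normM_smul K τ σ a d
      add_le := fun u v => normM_add_le K hτ hσ hK.le u v
      sq_convex := fun a b t => ?_ }
  · -- lower bound
    have h := norm_sq_le_normM_sq K hτ hσ hK.le d
    have h2 : (Real.sqrt ((1 - Real.sqrt (τ * σ) * ‖K‖) * min τ⁻¹ σ⁻¹) * ‖d‖) ^ 2 ≤
        normM K τ σ d ^ 2 := by
      rw [mul_pow, Real.sq_sqrt (mul_pos hc hmin).le]; exact h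
    exact (pow_le_pow_iff_left₀ (by positivity) (normM_nonneg K τ σ d) two_ne_zero).1 h2
  · -- upper bound
    have h := qM_le_norm_sq K hτ hσ d
    have h2 : normM K τ σ d ^ 2 ≤ (Real.sqrt (τ⁻¹ + σ⁻¹ + 2 * ‖K‖) * ‖d‖) ^ 2 := by
      rw [normM_sq K hτ hσ hK.le, mul_pow, Real.sq_sqrt (by positivity)]; exact h
    exact (pow_le_pow_iff_left₀ (normM_nonneg K τ σ d) (by positivity) two_ne_zero).1 h2
  · -- the parallelogram-type identity
    rw [normM_sq K hτ hσ hK.le, normM_sq K hτ hσ hK.le, normM_sq K hτ hσ hK.le,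
      normM_sq K hτ hσ hK.le]
    exact qM_convex_combination K τ σ a b t

/-- **Safeguarded Anderson acceleration of the PDHG kernel converges to a saddle point**
([ZOB20, Thm 6] transported to the metric `M_{τ,σ}` in which one PDHG step is a proximal-point step
[CP15, (12)–(13)] and hence non-expansive towards saddle points [AHLL, Prop 2 (i)]). Let `X`, `Y` be
finite-dimensional real Hilbert spaces, `K : X → Y` linear, `A ⊂ X × X`, `B ⊂ Y × Y` monotone with
resolvent maps `jA = J_{τA}`, `jB = J_{σB}`, FIXED step sizes `τ, σ > 0` with `τσ‖K‖² < 1`, and assume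
a saddle point exists (`zer F ≠ ∅`, `F = (A + K*·) × (B − K·)`). Let `z : ℕ → X × Y` follow the
safeguarded scheme on `f = pdhgStep K τ σ jA jB` (`0 < α < 1`, `C ≥ 0`, `b ≥ 0` summable; safeguard in
the norm of `X × Y`). Then `z^k → z⋆` for some saddle point `z⋆`.
[cite: ZhangOdonoghueBoyd2020, §4 Thm 6; §6 Cor 8] [cite: ChambollePock2015, §3 (12)–(13)]
[cite: ApplegateEtAl2022, Proposition 2 (i)] -/
theorem exists_tendsto_of_isSafeguardedAA_pdhgStep [FiniteDimensional ℝ X] [FiniteDimensional ℝ Y]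
    (K : X →L[ℝ] Y) {A : Set (X × X)} {B : Set (Y × Y)} {τ σ : ℝ} (hτ : 0 < τ) (hσ : 0 < σ)
    (hK : τ * σ * ‖K‖ ^ 2 < 1) (hA : IsMonotone A) (hB : IsMonotone B) {jA : X → X} {jB : Y → Y}
    (hjA : IsResolventMap τ A jA) (hjB : IsResolventMap σ B jB)
    (hsad : (zer (kkt K A B)).Nonempty) {α C : ℝ} {b : ℕ → ℝ} {S : ℕ → Prop} (hα0 : 0 < α)
    (hα1 : α < 1) (hC : 0 ≤ C) (hb : ∀ i, 0 ≤ b i) (hbs : Summable b) {z : ℕ → X × Y}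
    (hz : IsSafeguardedAA (pdhgStep K τ σ jA jB) α C b S z) :
    ∃ zs : X × Y, WithLp.toLp 2 zs ∈ zer (kkt K A B) ∧ Tendsto z atTop (𝓝 zs) := by
  have hN := isEuclideanGauge_normM K hτ hσ hK
  have hfix : ∀ u : X × Y, u ∈ Function.fixedPoints (pdhgStep K τ σ jA jB) ↔
      WithLp.toLp 2 u ∈ zer (kkt K A B) := fun u =>
    (pdhgStep_eq_self_iff K hτ hσ hA hB hjA hjB u)
  obtain ⟨ps, hps⟩ := hsad
  have hne : (Function.fixedPoints (pdhgStep K τ σ jA jB)).Nonempty :=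
    ⟨WithLp.ofLp ps, (hfix _).2 (by simpa using hps)⟩
  have hq : ∀ y ∈ Function.fixedPoints (pdhgStep K τ σ jA jB), ∀ u,
      normM K τ σ (pdhgStep K τ σ jA jB u - y) ≤ normM K τ σ (u - y) := fun y hy u =>
    normM_pdhgStep_sub_le K hτ hσ hK.le hA hB hjA hjB ((hfix y).1 hy) u
  obtain ⟨zs, hzs, hlim⟩ := exists_tendsto_of_isSafeguardedAA_gauge hN
    (continuous_pdhgStep K hτ hσ hA hB hjA hjB) hq hne hα0 hα1 hC hb hbs hz
  exact ⟨zs, (hfix zs).1 hzs, hlim⟩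

end PDHG

/-! ## §4 Plain steps of a FIRMLY (quasi-)nonexpansive map (`α = 1`): the reflection trick, and the
PDHG kernel as run (plain PDHG steps between accepted Anderson steps) -/

section Firm

variable {E : Type*} [NormedAddCommGroup E] [NormedSpace ℝ E]
variable {N : E → ℝ} {m Mu : ℝ} {f : E → E} {C : ℝ} {b : ℕ → ℝ} {S : ℕ → Prop} {x : ℕ → E}

/-- If `f` is FIRMLY quasi-nonexpansive in the gauge towards `y`
(`N(f z − y)² + N(z − f z)² ≤ N(z − y)²`, the Fejér inequality of a proximal-point / resolvent step),
then its reflection `R = 2f − I` is quasi-nonexpansive in the gauge: `N(R z − y) ≤ N(z − y)` — so that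
the PLAIN step `z⁺ = f(z) = ½ z + ½ R z` is the KM step of `R` with `α = ½` ("`f(x) = x/2 + C_A C_B(x)/2`
is a ½-averaged (and hence non-expansive) operator"). [cite: ZhangOdonoghueBoyd2020, §5.1.2 (DRS as a ½-averaged map)]
[cite: ChambollePock2015, §3 (12)–(13) (PDHG = proximal point step in M)] -/
theorem IsEuclideanGauge.reflect_le_of_firm (hN : IsEuclideanGauge N m Mu) {y z : E}
    (hfirm : N (f z - y) ^ 2 + N (z - f z) ^ 2 ≤ N (z - y) ^ 2) :
    N (((2 : ℝ) • f z - z) - y) ≤ N (z - y) := by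
  have h1 : ((2 : ℝ) • f z - z) - y = (1 - (2 : ℝ)) • (z - y) + (2 : ℝ) • (f z - y) := by module
  have h2 : (z - y) - (f z - y) = z - f z := by abel
  have h3 : N (((2 : ℝ) • f z - z) - y) ^ 2 ≤ N (z - y) ^ 2 := by
    rw [h1, hN.sq_convex, h2]
    nlinarith
  exact (pow_le_pow_iff_left₀ (hN.nonneg _) (hN.nonneg _) two_ne_zero).1 h3

/-- **The reflection trick.** The safeguarded scheme with PLAIN steps `x^{k+1} = f(x^k)` (`α = 1`) is the
safeguarded scheme for the reflection `R = 2f − I` with `α = ½`, step constant `C/2` and envelope `2b`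
(the residual of `R` is twice that of `f`). [cite: ZhangOdonoghueBoyd2020, §5.1.2 (DRS as a ½-averaged map), §4 Thm 6] -/
theorem isSafeguardedAA_reflect (hx : IsSafeguardedAA f 1 C b S x) :
    IsSafeguardedAA (fun z => (2 : ℝ) • f z - z) (1 / 2) (C / 2) (fun i => 2 * b i) S x := by
  have hres : ∀ z, resid (fun z => (2 : ℝ) • f z - z) z = (2 : ℝ) • resid f z := fun z => by
    simp only [resid]; module
  have hnorm : ∀ z, ‖resid (fun z => (2 : ℝ) • f z - z) z‖ = 2 * ‖resid f z‖ := fun z => by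
    rw [hres, norm_smul, Real.norm_eq_abs, abs_of_pos (by norm_num : (0 : ℝ) < 2)]
  refine ⟨fun k hk => ?_, fun k hk => ?_, fun k hk => ?_⟩
  · rw [hx.km_step k hk]; module
  · rw [hnorm]
    have h := hx.resid_le k hk
    linarith
  · rw [hnorm]
    have h := hx.step_le k hk
    linarith

/-- **[ZOB20, Thm 6] for plain steps of a firmly quasi-nonexpansive map.** On a proper real normed space
with an equivalent Euclidean gauge `N`, let `f` be continuous and firmly quasi-nonexpansive in `N`
towards its nonempty fixed-point set (`N(f z − y)² + N(z − f z)² ≤ N(z − y)²` — resolvent / proximal-point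
maps, the PDHG step in `M_{τ,σ}`, the Douglas–Rachford step), `C ≥ 0`, `b ≥ 0` summable. Then the
safeguarded scheme with PLAIN fall-back steps `x^{k+1} = f(x^k)` (`α = 1`) converges to a fixed point.
[cite: ZhangOdonoghueBoyd2020, §4 Thm 6; §5.1.2] [cite: ChambollePock2015, §3 (12)–(13)] -/
theorem exists_tendsto_of_isSafeguardedAA_gauge_of_firm [ProperSpace E] (hN : IsEuclideanGauge N m Mu)
    (hf : Continuous f)
    (hfirm : ∀ y ∈ Function.fixedPoints f, ∀ z, N (f z - y) ^ 2 + N (z - f z) ^ 2 ≤ N (z - y) ^ 2)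
    (hne : (Function.fixedPoints f).Nonempty) (hC : 0 ≤ C) (hb : ∀ i, 0 ≤ b i) (hbs : Summable b)
    (hx : IsSafeguardedAA f 1 C b S x) :
    ∃ xs ∈ Function.fixedPoints f, Tendsto x atTop (𝓝 xs) := by
  set R : E → E := fun z => (2 : ℝ) • f z - z with hR
  have hfixR : Function.fixedPoints R = Function.fixedPoints f := by
    ext z
    simp only [Function.mem_fixedPoints, Function.IsFixedPt, hR]
    constructor
    · intro h
      have h2 : (2 : ℝ) • f z = (2 : ℝ) • z := by
        rw [sub_eq_iff_eq_add] at h; rw [h]; module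
      exact smul_right_injective E (by norm_num : (2 : ℝ) ≠ 0) h2
    · intro h; rw [h]; module
  have hcontR : Continuous R := (hf.const_smul (2 : ℝ)).sub continuous_id
  have hqR : ∀ y ∈ Function.fixedPoints R, ∀ z, N (R z - y) ≤ N (z - y) := fun y hy z => by
    rw [hfixR] at hy
    exact hN.reflect_le_of_firm (hfirm y hy z)
  have hneR : (Function.fixedPoints R).Nonempty := by rwa [hfixR]
  obtain ⟨xs, hxs, hlim⟩ := exists_tendsto_of_isSafeguardedAA_gauge hN hcontR hqR hneR
    (by norm_num : (0 : ℝ) < 1 / 2) (by norm_num : (1 : ℝ) / 2 < 1) (by positivity : 0 ≤ C / 2)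
    (fun i => mul_nonneg zero_le_two (hb i)) (hbs.mul_left 2) (isSafeguardedAA_reflect hx)
  exact ⟨xs, hfixR ▸ hxs, hlim⟩

end Firm

section PDHGPlain

open Literature.Analysis.Convex.MonotoneOperator (IsMonotone IsResolventMap zer)
open Literature.Analysis.Convex.PrimalDualHybridGradient
open Literature.Analysis.Convex.RestartedPDHG
open Literature.Analysis.Convex.DouglasRachford (normalCone isMonotone_normalCone isResolventMap_proj)
open Literature.Analysis.Convex.ConvexMetricProjection (proj)

variable {X Y : Type*} [NormedAddCommGroup X] [InnerProductSpace ℝ X] [CompleteSpace X]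
  [NormedAddCommGroup Y] [InnerProductSpace ℝ Y] [CompleteSpace Y]

/-- The PDHG step is FIRMLY quasi-nonexpansive in `‖·‖_M` towards saddle points:
`‖z⁺ − z*‖²_M + ‖z − z⁺‖²_M ≤ ‖z − z*‖²_M` (the tree's `fejer_step` in `normM` form).
[cite: ChambollePock2010, Theorem 1 (a)] [cite: ApplegateEtAl2022, Proposition 2 (i)] -/
theorem normM_pdhgStep_firm (K : X →L[ℝ] Y) {A : Set (X × X)} {B : Set (Y × Y)} {τ σ : ℝ}
    (hτ : 0 < τ) (hσ : 0 < σ) (hK : τ * σ * ‖K‖ ^ 2 ≤ 1) (hA : IsMonotone A) (hB : IsMonotone B)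
    {jA : X → X} {jB : Y → Y} (hjA : IsResolventMap τ A jA) (hjB : IsResolventMap σ B jB)
    {zs : X × Y} (hzs : WithLp.toLp 2 zs ∈ zer (kkt K A B)) (u : X × Y) :
    normM K τ σ (pdhgStep K τ σ jA jB u - zs) ^ 2 + normM K τ σ (u - pdhgStep K τ σ jA jB u) ^ 2 ≤
      normM K τ σ (u - zs) ^ 2 := by
  have h := fejer_step K hτ hσ hA hB hjA hjB hzs u
  rw [normM_sq K hτ hσ hK, normM_sq K hτ hσ hK, normM_sq K hτ hσ hK, qM_eq, qM_eq, qM_eq,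
    WithLp.toLp_sub, WithLp.toLp_sub, WithLp.toLp_sub]
  exact h

/-- **Safeguarded Anderson acceleration of PDHG with PLAIN PDHG fall-back steps converges to a saddle
point** — the form in which an AA-PDHG kernel is run (accepted Anderson-mixed points under the safeguard,
otherwise the plain PDHG update `z^{k+1} = pdhgStep z^k`): finite-dimensional `X`, `Y`; monotone `A`, `B`
with resolvent maps; FIXED `τ, σ > 0`, `τσ‖K‖² < 1`; a saddle point exists; `C ≥ 0`, `b ≥ 0` summable;
`IsSafeguardedAA (pdhgStep K τ σ jA jB) 1 C b S z`. Then `z^k → z⋆ ∈ zer F`.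
[cite: ZhangOdonoghueBoyd2020, §4 Thm 6; §5.1.2] [cite: ChambollePock2015, §3 (12)–(13)]
[cite: ApplegateEtAl2022, Proposition 2 (i)] -/
theorem exists_tendsto_of_isSafeguardedAA_pdhgStep_plain [FiniteDimensional ℝ X]
    [FiniteDimensional ℝ Y] (K : X →L[ℝ] Y) {A : Set (X × X)} {B : Set (Y × Y)} {τ σ : ℝ}
    (hτ : 0 < τ) (hσ : 0 < σ) (hK : τ * σ * ‖K‖ ^ 2 < 1) (hA : IsMonotone A) (hB : IsMonotone B)
    {jA : X → X} {jB : Y → Y} (hjA : IsResolventMap τ A jA) (hjB : IsResolventMap σ B jB)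
    (hsad : (zer (kkt K A B)).Nonempty) {C : ℝ} {b : ℕ → ℝ} {S : ℕ → Prop} (hC : 0 ≤ C)
    (hb : ∀ i, 0 ≤ b i) (hbs : Summable b) {z : ℕ → X × Y}
    (hz : IsSafeguardedAA (pdhgStep K τ σ jA jB) 1 C b S z) :
    ∃ zs : X × Y, WithLp.toLp 2 zs ∈ zer (kkt K A B) ∧ Tendsto z atTop (𝓝 zs) := by
  have hN := isEuclideanGauge_normM K hτ hσ hK
  have hfix : ∀ u : X × Y, u ∈ Function.fixedPoints (pdhgStep K τ σ jA jB) ↔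
      WithLp.toLp 2 u ∈ zer (kkt K A B) := fun u =>
    (pdhgStep_eq_self_iff K hτ hσ hA hB hjA hjB u)
  obtain ⟨ps, hps⟩ := hsad
  have hne : (Function.fixedPoints (pdhgStep K τ σ jA jB)).Nonempty :=
    ⟨WithLp.ofLp ps, (hfix _).2 (by simpa using hps)⟩
  have hfirm : ∀ y ∈ Function.fixedPoints (pdhgStep K τ σ jA jB), ∀ u,
      normM K τ σ (pdhgStep K τ σ jA jB u - y) ^ 2 +
          normM K τ σ (u - pdhgStep K τ σ jA jB u) ^ 2 ≤ normM K τ σ (u - y) ^ 2 := fun y hy u =>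
    normM_pdhgStep_firm K hτ hσ hK.le hA hB hjA hjB ((hfix y).1 hy) u
  obtain ⟨zs, hzs, hlim⟩ := exists_tendsto_of_isSafeguardedAA_gauge_of_firm hN
    (continuous_pdhgStep K hτ hσ hA hB hjA hjB) hfirm hne hC hb hbs hz
  exact ⟨zs, (hfix zs).1 hzs, hlim⟩

/-- **The conic / projection form** (the PDLP-type kernel of the cell's cone programs): nonempty closed
convex `C ⊆ X`, `D ⊆ Y`, costs `c`, `b`, PDHG with the resolvent maps `x ↦ P_C(x − τc)`,
`y ↦ P_D(y − σb)`, FIXED `τσ‖K‖² < 1`, a saddle point of `⟨c,x⟩ + ⟨Kx,y⟩ − ⟨b,y⟩` on `C × D` exists: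
safeguarded Anderson acceleration with plain PDHG fall-back steps converges to a saddle point.
[cite: ZhangOdonoghueBoyd2020, §4 Thm 6] [cite: ChambollePock2010, Theorem 1 (c)]
[cite: ChambollePock2015, §3 (11)–(13)] -/
theorem exists_tendsto_of_isSafeguardedAA_pdhgStep_conic [FiniteDimensional ℝ X]
    [FiniteDimensional ℝ Y] (K : X →L[ℝ] Y) {C : Set X} {D : Set Y} (hCne : C.Nonempty)
    (hCcl : IsClosed C) (hCc : Convex ℝ C) (hDne : D.Nonempty) (hDcl : IsClosed D)
    (hDc : Convex ℝ D) (c : X) (b₀ : Y) {τ σ : ℝ} (hτ : 0 < τ) (hσ : 0 < σ)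
    (hK : τ * σ * ‖K‖ ^ 2 < 1)
    (hsad : (zer (kkt K (shiftOp c (normalCone C)) (shiftOp b₀ (normalCone D)))).Nonempty)
    {Cst : ℝ} {b : ℕ → ℝ} {S : ℕ → Prop} (hC : 0 ≤ Cst) (hb : ∀ i, 0 ≤ b i) (hbs : Summable b)
    {z : ℕ → X × Y}
    (hz : IsSafeguardedAA
      (pdhgStep K τ σ (fun x => proj C (x - τ • c)) (fun y => proj D (y - σ • b₀))) 1 Cst b S z) :
    ∃ zs : X × Y, WithLp.toLp 2 zs ∈ zer (kkt K (shiftOp c (normalCone C)) (shiftOp b₀ (normalCone D)))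
      ∧ Tendsto z atTop (𝓝 zs) :=
  exists_tendsto_of_isSafeguardedAA_pdhgStep_plain K hτ hσ hK
    (isMonotone_shiftOp c (isMonotone_normalCone C)) (isMonotone_shiftOp b₀ (isMonotone_normalCone D))
    (isResolventMap_shiftOp (isResolventMap_proj hCne hCcl.isComplete hCc hτ))
    (isResolventMap_shiftOp (isResolventMap_proj hDne hDcl.isComplete hDc hσ)) hsad hC hb hbs hz

end PDHGPlain

/-! ## §5 Plain Douglas–Rachford fall-back steps (the SCS form of [ZOB20, §5.1.2]) -/

section DRPlain

open Literature.Analysis.Convex.MonotoneOperator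
open Literature.Analysis.Convex.DouglasRachford

variable {H : Type*} [NormedAddCommGroup H] [InnerProductSpace ℝ H]
variable {γ : ℝ} {A B : Set (H × H)} {ja jb : H → H} {C : ℝ} {b : ℕ → ℝ} {S : ℕ → Prop}
  {z : ℕ → H}

/-- The Douglas–Rachford step is FIRMLY quasi-nonexpansive towards its fixed points:
`‖G u − p‖² + ‖u − G u‖² ≤ ‖u − p‖²` for `G p = p` (from the tree's firm nonexpansiveness
`norm_drStep_sub_sq_le_inner` = [EB92, Cor 4.1]). [cite: EcksteinBertsekas1992, §4 Cor 4.1]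
[cite: ZhangOdonoghueBoyd2020, §5.1.2 ("a ½-averaged (and hence non-expansive) operator")] -/
theorem norm_drStep_firm (hja : IsResolventMap γ A ja) (hjb : IsResolventMap γ B jb)
    (hA : IsMonotone A) (hB : IsMonotone B) (hγ : 0 < γ) {p : H} (hp : drStep ja jb p = p)
    (u : H) : ‖drStep ja jb u - p‖ ^ 2 + ‖u - drStep ja jb u‖ ^ 2 ≤ ‖u - p‖ ^ 2 := by
  have h := norm_drStep_sub_sq_le_inner hja hjb hA hB hγ p u
  rw [hp] at h
  have e : u - drStep ja jb u = (u - p) - (drStep ja jb u - p) := by abel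
  have key : ‖(u - p) - (drStep ja jb u - p)‖ ^ 2 =
      ‖u - p‖ ^ 2 - 2 * ⟪u - p, drStep ja jb u - p⟫ + ‖drStep ja jb u - p‖ ^ 2 :=
    norm_sub_sq_real _ _
  rw [e, key]
  linarith

/-- **Safeguarded Anderson acceleration of Douglas–Rachford splitting with PLAIN DR fall-back steps**
(`α = 1`; the form used by conic splitting solvers that apply AA to the DR/ADMM map itself): `A`, `B`
monotone with resolvent maps (`λ > 0`), `zer(A + B) ≠ ∅`, proper space, `C ≥ 0`, `b ≥ 0` summable,
`IsSafeguardedAA (drStep ja jb) 1 C b S z` ⇒ `z^k → z⋆ = G z⋆` and the shadow `J_{λB} z^k → J_{λB} z⋆ ∈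
zer(A + B)`. [cite: ZhangOdonoghueBoyd2020, §5.1.2 with §4 Thm 6] [cite: EcksteinBertsekas1992, §4 Cor 4.1 and Thm 5] -/
theorem exists_tendsto_of_isSafeguardedAA_drStep_plain [ProperSpace H] (hja : IsResolventMap γ A ja)
    (hjb : IsResolventMap γ B jb) (hA : IsMonotone A) (hB : IsMonotone B) (hγ : 0 < γ)
    (hzer : (zer (opSum A B)).Nonempty) (hC : 0 ≤ C) (hb : ∀ i, 0 ≤ b i) (hbs : Summable b)
    (hz : IsSafeguardedAA (drStep ja jb) 1 C b S z) :
    ∃ zs : H, drStep ja jb zs = zs ∧ jb zs ∈ zer (opSum A B) ∧ Tendsto z atTop (𝓝 zs) ∧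
      Tendsto (fun k => jb (z k)) atTop (𝓝 (jb zs)) := by
  obtain ⟨x, hx⟩ := hzer
  obtain ⟨p, hp, -⟩ := exists_drStep_eq_self_of_mem_zer hja hjb hA hB hγ hx
  have hne : (Function.fixedPoints (drStep ja jb)).Nonempty := ⟨p, hp⟩
  have hcont : Continuous (drStep ja jb) :=
    (LipschitzWith.of_dist_le_mul (K := 1) fun u v => by
      simpa [dist_eq_norm] using norm_drStep_sub_le hja hjb hA hB hγ v u).continuous
  have hfirm : ∀ y ∈ Function.fixedPoints (drStep ja jb), ∀ u,
      ‖drStep ja jb u - y‖ ^ 2 + ‖u - drStep ja jb u‖ ^ 2 ≤ ‖u - y‖ ^ 2 := fun y hy u =>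
    norm_drStep_firm hja hjb hA hB hγ hy u
  obtain ⟨zs, hzs, hlim⟩ := exists_tendsto_of_isSafeguardedAA_gauge_of_firm
    (isEuclideanGauge_norm (F := H)) hcont hfirm hne hC hb hbs hz
  have hzs' : drStep ja jb zs = zs := hzs
  exact ⟨zs, hzs', apply_mem_zer_opSum_of_drStep_eq_self hja hjb hA hB hγ hzs', hlim,
    ((hjb.continuous hB hγ).tendsto zs).comp hlim⟩

end DRPlain

end Literature.Analysis.Convex.AndersonAccelerationPDHG
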